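import Summits.QuantumFields.BalabanUV.Beta.FP.TorusCombTranslate
import Summits.QuantumFields.BalabanUV.Beta.FP.TorusNestedReadoutLocality

/-!
# `BalabanUV.Beta.FP.TorusNestedReadoutTranslate` — road «FP», binder row D1, ROUTE T (β1), STUB P of the row's ONE file, (C) part 2 of 5 (J-NOTE-20 §8, R-AN2-76-PB's VALUE half):
# **CLOSED FORMS OF THE COMB ROWS AND OF THE EVALUATION MATRIX ONE LEVEL DOWN; `bigP`, `combF`, `towerGen`, `towerEvalC` AGREE AT CORRESPONDING SLOTS ∕ BONDS OF TWO TOWERS**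

SETTING (parts 1–5 of (C)).  Two towers over top tori `M`, `M′` (`Lc ∣ M i`, `Lc ∣ M′ i`), same `Lc`, `lev`, `rs`, depth `n+1`; a block shift `v : Site (d+1)`: top sites move by
`Lc • v`, the finest sites by `bigRatio Lc (n+1) • v = Lc^(n+2) • v`; slots correspond («Corr») when the sites of `towerEquiv⁻¹` differ by that shift, finest bonds when their base
points do (same direction).  Objects as in parts (A1)(A2): `N := fromRows (τ₂·Q₁₀) τ₁` (letter `hN`), `Q₁₀ = compRowsG Lc Q M lev rs (n+1)` for a GENERIC `Q : StepRows d Lc`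
under the displayed letters (TB) (two-block support of non-wrapping rows) and (TQ) (block-translation covariance of non-wrapping rows:
`↑a′ = ↑a + Lc•v → ↑b′ = ↑b + Lc•(Lc•v) → ↑a + e_ν ∈ pbox M → ↑a′ + e_ν ∈ pbox M′ → Q M ℓ r (a,ν) (b,κ) = Q M′ ℓ r (a′,ν) (b′,κ)`), both discharged at the record's `QSym Lc`
(`FP/QstepSymTwoBlock`, `FP/QstepSymBlockTranslate`); `τ₁ = bigP` of the lower tower, `τ₂ = combF`, `W₀ = towerGen`, `E = towerEvalC`.

WHAT, this part ([folklore]; no `def`, no `def … : Prop`, nothing cited, 0 sorry, default heartbeats): §1 closed forms: `bigP_apply_eq` ∕ `combF_apply_eq` (`[b = the comb bond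
into the slot's site]`, `combBondT_eq`), **`combF_mul_apply`** (`(combF · X) t̄ c = X (comb bond into t̄) c`), **`towerEvalC_succ_inl_inl ∕ _inl_inr ∕ _inr_inl ∕ _inr_inr`**
(`towerEvalC (k+1)` on the four slot blocks: `[t̄ = t̄₂]`, `0`, `[quo R′ (lower site) = t̄]`, the lower `towerEvalC` — from `evalC = fromBlocks 1 0 E 1` and `lowerSort`); §2
**`bigP_apply_corr`**, **`combF_apply_corr`** (covariance of `baseOf ∕ axisOf`), **`towerGen_apply_corr`** (induction on the depth at NON-WRAPPING corresponding bonds: the top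
block-constant modes read `quo R′` of both endpoints — `quo_add_zsmul` —, the lower modes by the induction hypothesis at the lower shift; `corr_succ_inl ∕ _inr` sort the
partner), **`towerEvalC_apply_corr`** (induction over §1's closed forms).
WHAT THIS IS NOT: not (P-c) itself (the lattice `λℤ` as a `def`, its `Mc B`-periodisation = `lv` — the row's, on top of this identity); `hlve` NOT instantiated; no row of
v9∕v10 discharged; nothing of Bałaban's asserted, valued or discharged; 0 estimates; 0∕4 row-D1 binders (hW, hR, D1Tel, D1Rep); ROOT M‴ p325680 untouched; NOT (C1), NOT (L2′),
NOT (T-ID), NOT SDF, NOT D1, NEVER «G-an2-4 closed», NOT BetaPertH, NOT continuum, NOT Clay.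

HONEST DEPENDENCY (page 1, mandatory): continuum YM on T⁴ ⇐ BetaPertH ∧ nine spine estimates (0/9 proved); BetaPertH ⇐ (D1) ∧ (D4) ∧ CAP+tail;
G-an2-4 gates asym, D1 and NE2/3/4.  HONEST FRAMING (cell contract, verbatim): «discharging `BetaPertH` makes Bałaban's UV stability UNCONDITIONAL —
a real constructive-QFT result; it is NOT the continuum limit and NOT the Clay problem.»  ABSOLUTE RULE (cell charter, verbatim): «No internally-minted
statement may enter as a cited fact. Every hypothesis is either kernel-proved in this package or a verbatim quotation of a PUBLISHED theorem with page
reference. The manuscript(s) under audit are NOT citable for their own disputed steps — they are the thing under adjudication; programme-internal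
(2001/route/tribunal) claims are never citable.»  Road «FP» OWNER, b2b-balaban-beta-d1-p3 gen 54, 2026-08-29.  No existing file touched.
-/

noncomputable section

namespace Summit.QuantumFields.BalabanUV.Beta.FP.TorusNestedReadoutTranslate

open Matrix Finset
open scoped BigOperators
open Literature.MathematicalPhysics.QuantumFieldTheory
open Literature.MathematicalPhysics.QuantumFieldTheory.Balaban1983to89
open Literature.MathematicalPhysics.QuantumFieldTheory.Balaban1983to89.Beta
open B5Prop11Plancherel (fine)
open B6Lemma24Torus (pbox mem_pbox)
open AffineAveraging (Site toSite unitVec)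
open OneStepResolventKernel (Fib)
open Literature.MathematicalPhysics.QuantumFieldTheory.LatticeForm (quo)
open Summit.QuantumFields.BalabanUV.Beta.FP.KernelPeriodisationFib (Idx)
open Summit.QuantumFields.BalabanUV.Beta.FP.TorusGaugeCovariance (tgrad tgrad_inl tdelta tdelta_of_mem)
open Summit.QuantumFields.BalabanUV.Beta.FP.TorusGaugeCovarianceCoarse (tgradBlock tgradBlock_inl)
open Summit.QuantumFields.BalabanUV.Beta.FP.TorusCombForest
open Summit.QuantumFields.BalabanUV.Beta.FP.TorusCombRows (Res combRowsT combBondT combBondT_eq baseOf_mem_pbox tipOf_mem_pbox)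
open Summit.QuantumFields.BalabanUV.Beta.FP.TorusCombNestedBasis (resBigEquiv evalC evalE quo_lift quo_mem_pbox)
open Summit.QuantumFields.BalabanUV.Beta.FP.TorusCompositeObjects
open Summit.QuantumFields.BalabanUV.Beta.FP.TorusCompositeObjectsG (StepRows compRowsG compRowsG_zero compRowsG_succ)
open Summit.QuantumFields.BalabanUV.Beta.FP.TorusCompositeUnimodular (towerEvalC lowerSort towerEquiv_succ bigRatio_dvd_towerTorus)
open Summit.QuantumFields.BalabanUV.Beta.FP.TorusNestedReadoutRows
open Summit.QuantumFields.BalabanUV.Beta.FP.TorusNestedReadoutLocality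
open Summit.QuantumFields.BalabanUV.Beta.FP.TorusCombTranslate

variable {d : ℕ}

/-! ## §1 Closed forms: a one-shot comb row, a top comb row, the top comb rows composed with a matrix, the evaluation matrix one level down -/

section ClosedForms

variable (Lc : ℕ) [NeZero Lc]

/-- [folklore] closed form of a one-shot comb row: `bigP p b = [b = the comb bond into the site of p]`. -/
theorem bigP_apply_eq (M : Fin (d + 1) → ℕ) (rs : ℕ → (Fin (d + 1) → ℕ)) (hrs : ∀ k i, 0 ≤ toSite (rs k) i ∧ toSite (rs k) i < (Lc : ℤ))
    (hM : ∀ i, Lc ∣ M i) (k : ℕ) (p : NParam Lc M rs k) (b : ↥(pbox (towerTorus Lc M k)) × Fin (d + 1)) :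
    bigP Lc M rs hrs k p b = if (b.1 : Site (d + 1)) = baseOf (bigRoot Lc rs k) (bigRatio Lc k) ((towerEquiv Lc M rs hrs k).symm p).site ∧
      b.2 = axisOf (bigRoot Lc rs k) (bigRatio Lc k) ((towerEquiv Lc M rs hrs k).symm p).site then 1 else 0 := by
  have hLc : 0 < Lc := Nat.pos_of_ne_zero (NeZero.ne Lc)
  have key := combBondT_eq (bigRatio_pos Lc hLc k) (bigRoot_range Lc hLc k rs hrs) (bigRatio_dvd_towerTorus Lc hM k) ((towerEquiv Lc M rs hrs k).symm p)
  by_cases he : ((b.1, Sum.inl b.2) : Idx (towerTorus Lc M k) (Fib d)) = combBondT (bigRoot Lc rs k) (bigRatio Lc k) (towerTorus Lc M k) ((towerEquiv Lc M rs hrs k).symm p)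
  · have he' := he
    rw [key, Prod.mk.injEq, Sum.inl.injEq] at he'
    rw [if_pos ⟨congrArg Subtype.val he'.1, he'.2⟩]
    show (if ((b.1, Sum.inl b.2) : Idx (towerTorus Lc M k) (Fib d)) = combBondT (bigRoot Lc rs k) (bigRatio Lc k) (towerTorus Lc M k)
      ((towerEquiv Lc M rs hrs k).symm p) then (1 : ℝ) else 0) = 1
    rw [if_pos he]
  · have hne : ¬ ((b.1 : Site (d + 1)) = baseOf (bigRoot Lc rs k) (bigRatio Lc k) ((towerEquiv Lc M rs hrs k).symm p).site ∧
        b.2 = axisOf (bigRoot Lc rs k) (bigRatio Lc k) ((towerEquiv Lc M rs hrs k).symm p).site) := by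
      intro h2; apply he; rw [key]
      exact Prod.ext (Subtype.ext h2.1) (congrArg Sum.inl h2.2)
    rw [if_neg hne]
    show (if ((b.1, Sum.inl b.2) : Idx (towerTorus Lc M k) (Fib d)) = combBondT (bigRoot Lc rs k) (bigRatio Lc k) (towerTorus Lc M k)
      ((towerEquiv Lc M rs hrs k).symm p) then (1 : ℝ) else 0) = 0
    rw [if_neg he]

/-- [folklore] closed form of a top comb row: `combF t̄ a = [a = the comb bond into t̄]`. -/
theorem combF_apply_eq (M : Fin (d + 1) → ℕ) (r : Fin (d + 1) → ℕ) (hr : ∀ i, 0 ≤ toSite r i ∧ toSite r i < (Lc : ℤ)) (hM : ∀ i, Lc ∣ M i)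
    (t : Res (toSite r) Lc M) (a : ↥(pbox M) × Fin (d + 1)) :
    combF Lc M r t a = if (a.1 : Site (d + 1)) = baseOf (toSite r) Lc t.site ∧ a.2 = axisOf (toSite r) Lc t.site then 1 else 0 := by
  have hLc : 0 < Lc := Nat.pos_of_ne_zero (NeZero.ne Lc)
  have key := combBondT_eq hLc hr hM t
  by_cases he : ((a.1, Sum.inl a.2) : Idx M (Fib d)) = combBondT (toSite r) Lc M t
  · have he' := he
    rw [key, Prod.mk.injEq, Sum.inl.injEq] at he'
    rw [if_pos ⟨congrArg Subtype.val he'.1, he'.2⟩]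
    show (if ((a.1, Sum.inl a.2) : Idx M (Fib d)) = combBondT (toSite r) Lc M t then (1 : ℝ) else 0) = 1
    rw [if_pos he]
  · have hne : ¬ ((a.1 : Site (d + 1)) = baseOf (toSite r) Lc t.site ∧ a.2 = axisOf (toSite r) Lc t.site) := by
      intro h2; apply he; rw [key]
      exact Prod.ext (Subtype.ext h2.1) (congrArg Sum.inl h2.2)
    rw [if_neg hne]
    show (if ((a.1, Sum.inl a.2) : Idx M (Fib d)) = combBondT (toSite r) Lc M t then (1 : ℝ) else 0) = 0
    rw [if_neg he]

/-- [folklore] **THE TOP COMB ROW TIMES A MATRIX READS ONE ROW**: `(combF · X) t̄ c = X (comb bond into t̄) c`. -/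
theorem combF_mul_apply (M : Fin (d + 1) → ℕ) (r : Fin (d + 1) → ℕ) (hr : ∀ i, 0 ≤ toSite r i ∧ toSite r i < (Lc : ℤ)) (hM : ∀ i, Lc ∣ M i)
    {o : Type*} (X : Matrix (↥(pbox M) × Fin (d + 1)) o ℝ) (t : Res (toSite r) Lc M) (c : o) :
    (combF Lc M r * X) t c = X (⟨baseOf (toSite r) Lc t.site, baseOf_mem_pbox (Nat.pos_of_ne_zero (NeZero.ne Lc)) hr hM t⟩, axisOf (toSite r) Lc t.site) c := by
  rw [Matrix.mul_apply, Finset.sum_eq_single (⟨baseOf (toSite r) Lc t.site, baseOf_mem_pbox (Nat.pos_of_ne_zero (NeZero.ne Lc)) hr hM t⟩, axisOf (toSite r) Lc t.site)]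
  · rw [combF_apply_eq Lc M r hr hM, if_pos ⟨rfl, rfl⟩, one_mul]
  · intro a _ ha
    rw [combF_apply_eq Lc M r hr hM, if_neg, zero_mul]
    intro h2; apply ha
    exact Prod.ext (Subtype.ext h2.1) h2.2
  · intro h; exact absurd (Finset.mem_univ _) h

/-- [folklore] the evaluation matrix one level down, top∕top: `[t̄ = t̄₂]`. -/
theorem towerEvalC_succ_inl_inl (M : Fin (d + 1) → ℕ) (rs : ℕ → (Fin (d + 1) → ℕ)) (hrs : ∀ k i, 0 ≤ toSite (rs k) i ∧ toSite (rs k) i < (Lc : ℤ))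
    (k : ℕ) (t t₂ : Res (toSite (rs 0)) Lc M) :
    towerEvalC Lc M rs hrs (k + 1) (Sum.inl t) (Sum.inl t₂) = if t = t₂ then 1 else 0 := by
  rw [towerEvalC, Matrix.submatrix_apply, Matrix.mul_apply, Fintype.sum_sum_type]
  have e1 : (lowerSort Lc M rs hrs k).symm (Sum.inl t) = Sum.inl t := rfl
  have e2 : (lowerSort Lc M rs hrs k).symm (Sum.inl t₂) = Sum.inl t₂ := rfl
  simp only [e1, e2, evalC, Matrix.fromBlocks_apply₁₁, Matrix.fromBlocks_apply₁₂, Matrix.fromBlocks_apply₂₁, Matrix.zero_apply, zero_mul,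
    Finset.sum_const_zero, add_zero, Matrix.one_apply, ite_mul, one_mul, Finset.sum_ite_eq, Finset.mem_univ, if_true]

/-- [folklore] the evaluation matrix one level down, top∕lower: `0`. -/
theorem towerEvalC_succ_inl_inr (M : Fin (d + 1) → ℕ) (rs : ℕ → (Fin (d + 1) → ℕ)) (hrs : ∀ k i, 0 ≤ toSite (rs k) i ∧ toSite (rs k) i < (Lc : ℤ))
    (k : ℕ) (t : Res (toSite (rs 0)) Lc M) (x : NParam Lc (fine Lc M) (fun j => rs (j + 1)) k) :
    towerEvalC Lc M rs hrs (k + 1) (Sum.inl t) (Sum.inr x) = 0 := by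
  rw [towerEvalC, Matrix.submatrix_apply, Matrix.mul_apply, Fintype.sum_sum_type]
  have e1 : (lowerSort Lc M rs hrs k).symm (Sum.inl t) = Sum.inl t := rfl
  have e2 : (lowerSort Lc M rs hrs k).symm (Sum.inr x) = Sum.inr (((resCongr (towerTorus_fine_eq_fine Lc M k).symm).trans
      (towerEquiv Lc (fine Lc M) (fun j => rs (j + 1)) (fun j => hrs (j + 1)) k)).symm x) := rfl
  simp only [e1, e2, evalC, Matrix.fromBlocks_apply₁₁, Matrix.fromBlocks_apply₁₂, Matrix.fromBlocks_apply₂₂, Matrix.zero_apply, zero_mul, mul_zero,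
    Finset.sum_const_zero, add_zero]

/-- [folklore] the evaluation matrix one level down, lower∕top: `[the lower slot's big block has index t̄]`. -/
theorem towerEvalC_succ_inr_inl (M : Fin (d + 1) → ℕ) (rs : ℕ → (Fin (d + 1) → ℕ)) (hrs : ∀ k i, 0 ≤ toSite (rs k) i ∧ toSite (rs k) i < (Lc : ℤ))
    (k : ℕ) (x : NParam Lc (fine Lc M) (fun j => rs (j + 1)) k) (t : Res (toSite (rs 0)) Lc M) :
    towerEvalC Lc M rs hrs (k + 1) (Sum.inr x) (Sum.inl t)
      = if quo (bigRatio Lc k) ((towerEquiv Lc (fine Lc M) (fun j => rs (j + 1)) (fun j => hrs (j + 1)) k).symm x).site = t.site then 1 else 0 := by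
  classical
  rw [towerEvalC, Matrix.submatrix_apply, Matrix.mul_apply, Fintype.sum_sum_type]
  have e1 : (lowerSort Lc M rs hrs k).symm (Sum.inl t) = Sum.inl t := rfl
  have e2 : (lowerSort Lc M rs hrs k).symm (Sum.inr x) = Sum.inr (((resCongr (towerTorus_fine_eq_fine Lc M k).symm).trans
      (towerEquiv Lc (fine Lc M) (fun j => rs (j + 1)) (fun j => hrs (j + 1)) k)).symm x) := rfl
  simp only [e1, e2, evalC, Matrix.fromBlocks_apply₂₁, Matrix.fromBlocks_apply₂₂, Matrix.fromBlocks_apply₁₁, Matrix.fromBlocks_apply₂₁, Matrix.zero_apply, mul_zero,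
    Finset.sum_const_zero, add_zero, Matrix.one_apply, mul_ite, mul_one, Finset.sum_ite_eq', Finset.mem_univ, if_true]
  simp only [evalE]
  rfl

/-- [folklore] the evaluation matrix one level down, lower∕lower: the lower evaluation matrix. -/
theorem towerEvalC_succ_inr_inr (M : Fin (d + 1) → ℕ) (rs : ℕ → (Fin (d + 1) → ℕ)) (hrs : ∀ k i, 0 ≤ toSite (rs k) i ∧ toSite (rs k) i < (Lc : ℤ))
    (k : ℕ) (x x₂ : NParam Lc (fine Lc M) (fun j => rs (j + 1)) k) :
    towerEvalC Lc M rs hrs (k + 1) (Sum.inr x) (Sum.inr x₂) = towerEvalC Lc (fine Lc M) (fun j => rs (j + 1)) (fun j => hrs (j + 1)) k x x₂ := by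
  rw [towerEvalC, Matrix.submatrix_apply, Matrix.mul_apply, Fintype.sum_sum_type]
  have e1 : (lowerSort Lc M rs hrs k).symm (Sum.inr x) = Sum.inr (((resCongr (towerTorus_fine_eq_fine Lc M k).symm).trans
      (towerEquiv Lc (fine Lc M) (fun j => rs (j + 1)) (fun j => hrs (j + 1)) k)).symm x) := rfl
  have e2 : (lowerSort Lc M rs hrs k).symm (Sum.inr x₂) = Sum.inr (((resCongr (towerTorus_fine_eq_fine Lc M k).symm).trans
      (towerEquiv Lc (fine Lc M) (fun j => rs (j + 1)) (fun j => hrs (j + 1)) k)).symm x₂) := rfl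
  simp only [e1, e2, evalC, Matrix.fromBlocks_apply₂₁, Matrix.fromBlocks_apply₂₂, Matrix.fromBlocks_apply₁₂, Matrix.zero_apply, mul_zero,
    Finset.sum_const_zero, zero_add, Matrix.one_apply, ite_mul, one_mul, zero_mul, Finset.sum_ite_eq, Finset.mem_univ, if_true, Matrix.submatrix_apply,
    Equiv.apply_symm_apply]

end ClosedForms

/-! ## §2 Corresponding slots ∕ bonds of two towers have the same one-shot comb rows, top comb rows, generator columns and evaluation entries -/

section Corr

variable (Lc : ℕ) [NeZero Lc]

/-- [folklore] **`bigP` AT CORRESPONDING SLOTS AND BONDS** (sites moved by `bigRatio Lc k • v`): equal (`baseOf ∕ axisOf` are block-translation covariant). -/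
theorem bigP_apply_corr (M M' : Fin (d + 1) → ℕ) (rs : ℕ → (Fin (d + 1) → ℕ)) (hrs : ∀ k i, 0 ≤ toSite (rs k) i ∧ toSite (rs k) i < (Lc : ℤ))
    (hM : ∀ i, Lc ∣ M i) (hM' : ∀ i, Lc ∣ M' i) (k : ℕ) (v : Site (d + 1)) (p : NParam Lc M rs k) (p' : NParam Lc M' rs k)
    (hp : ((towerEquiv Lc M' rs hrs k).symm p').site = ((towerEquiv Lc M rs hrs k).symm p).site + ((bigRatio Lc k : ℕ) : ℤ) • v)
    (b : ↥(pbox (towerTorus Lc M k)) × Fin (d + 1)) (b' : ↥(pbox (towerTorus Lc M' k)) × Fin (d + 1))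
    (hb : (b'.1 : Site (d + 1)) = (b.1 : Site (d + 1)) + ((bigRatio Lc k : ℕ) : ℤ) • v) (hb2 : b'.2 = b.2) :
    bigP Lc M rs hrs k p b = bigP Lc M' rs hrs k p' b' := by
  have hLc : 0 < Lc := Nat.pos_of_ne_zero (NeZero.ne Lc)
  have hR : 0 < bigRatio Lc k := bigRatio_pos Lc hLc k
  rw [bigP_apply_eq Lc M rs hrs hM k p b, bigP_apply_eq Lc M' rs hrs hM' k p' b', hp, hb, hb2, baseOf_add_zsmul hR, axisOf_add_zsmul hR]
  simp only [add_left_inj]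

/-- [folklore] **`combF` AT CORRESPONDING TOP SLOTS AND COARSE BONDS** (sites moved by `Lc • v`): equal. -/
theorem combF_apply_corr (M M' : Fin (d + 1) → ℕ) (r : Fin (d + 1) → ℕ) (hr : ∀ i, 0 ≤ toSite r i ∧ toSite r i < (Lc : ℤ)) (hM : ∀ i, Lc ∣ M i) (hM' : ∀ i, Lc ∣ M' i)
    (v : Site (d + 1)) (t : Res (toSite r) Lc M) (t' : Res (toSite r) Lc M') (ht : t'.site = t.site + (Lc : ℤ) • v)
    (a : ↥(pbox M) × Fin (d + 1)) (a' : ↥(pbox M') × Fin (d + 1)) (ha : (a'.1 : Site (d + 1)) = (a.1 : Site (d + 1)) + (Lc : ℤ) • v) (ha2 : a'.2 = a.2) :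
    combF Lc M r t a = combF Lc M' r t' a' := by
  have hLc : 0 < Lc := Nat.pos_of_ne_zero (NeZero.ne Lc)
  rw [combF_apply_eq Lc M r hr hM t a, combF_apply_eq Lc M' r hr hM' t' a', ht, ha, ha2, baseOf_add_zsmul hLc, axisOf_add_zsmul hLc]
  simp only [add_left_inj]

/-- [folklore] **`towerGen` AT CORRESPONDING NON-WRAPPING BONDS AND SLOTS**: equal (induction on the depth; the top block-constant modes read `quo R′` of the two
endpoints, covariant; the lower modes by the induction hypothesis at the lower tower's shift `Lc • v`). -/
theorem towerGen_apply_corr : ∀ (k : ℕ) (M M' : Fin (d + 1) → ℕ) [∀ μ, NeZero (M μ)] [∀ μ, NeZero (M' μ)] (rs : ℕ → (Fin (d + 1) → ℕ))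
    (hrs : ∀ j i, 0 ≤ toSite (rs j) i ∧ toSite (rs j) i < (Lc : ℤ)) (v : Site (d + 1))
    (b : ↥(pbox (towerTorus Lc M k)) × Fin (d + 1)) (b' : ↥(pbox (towerTorus Lc M' k)) × Fin (d + 1))
    (p : NParam Lc M rs k) (p' : NParam Lc M' rs k),
    ((towerEquiv Lc M' rs hrs k).symm p').site = ((towerEquiv Lc M rs hrs k).symm p).site + ((bigRatio Lc k : ℕ) : ℤ) • v →
    (b'.1 : Site (d + 1)) = (b.1 : Site (d + 1)) + ((bigRatio Lc k : ℕ) : ℤ) • v → b'.2 = b.2 →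
    (b.1 : Site (d + 1)) + unitVec b.2 ∈ pbox (towerTorus Lc M k) → (b'.1 : Site (d + 1)) + unitVec b'.2 ∈ pbox (towerTorus Lc M' k) →
      towerGen Lc M rs k b p = towerGen Lc M' rs k b' p'
  | 0, M, M', _, _, rs, hrs, v, b, b', p, p', hp, hb, hb2, hbt, hbt' => by
    have hp' : ((p'.1 : ↥(pbox M')) : Site (d + 1)) = ((p.1 : ↥(pbox M)) : Site (d + 1)) + ((bigRatio Lc 0 : ℕ) : ℤ) • v := hp
    rw [towerGen_zero, towerGen_zero, Matrix.submatrix_apply, Matrix.submatrix_apply, tgrad_inl, tgrad_inl,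
      tdelta_of_mem M (show (b.1 : Site (d + 1)) + unitVec b.2 ∈ pbox M from hbt),
      tdelta_of_mem M (show ((b.1 : ↥(pbox (towerTorus Lc M 0))) : Site (d + 1)) ∈ pbox M from b.1.2),
      tdelta_of_mem M' (show (b'.1 : Site (d + 1)) + unitVec b'.2 ∈ pbox M' from hbt'),
      tdelta_of_mem M' (show ((b'.1 : ↥(pbox (towerTorus Lc M' 0))) : Site (d + 1)) ∈ pbox M' from b'.1.2)]
    have c1 : ((b'.1 : Site (d + 1)) + unitVec b'.2 = ((p'.1 : ↥(pbox M')) : Site (d + 1))) ↔ ((b.1 : Site (d + 1)) + unitVec b.2 = ((p.1 : ↥(pbox M)) : Site (d + 1))) := by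
      rw [hb, hb2, hp', add_right_comm, add_left_inj]
    have c2 : ((b'.1 : Site (d + 1)) = ((p'.1 : ↥(pbox M')) : Site (d + 1))) ↔ ((b.1 : Site (d + 1)) = ((p.1 : ↥(pbox M)) : Site (d + 1))) := by
      rw [hb, hp', add_left_inj]
    simp only [c1, c2]
  | k + 1, M, M', _, _, rs, hrs, v, b, b', p, p', hp, hb, hb2, hbt, hbt' => by
    have hLc : 0 < Lc := Nat.pos_of_ne_zero (NeZero.ne Lc)
    have hR : 0 < bigRatio Lc k := bigRatio_pos Lc hLc k
    rcases p with t | x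
    · obtain ⟨t', rfl, ht⟩ := corr_succ_inl Lc M M' rs hrs k v t p' hp
      show tgradBlock M (bigRatio Lc k) ((pboxCongr (towerTorus_fine_eq_fine Lc M k) b.1 : ↥(pbox (fine (bigRatio Lc k) M))), Sum.inl b.2) (t.1 : ↥(pbox M))
        = tgradBlock M' (bigRatio Lc k) ((pboxCongr (towerTorus_fine_eq_fine Lc M' k) b'.1 : ↥(pbox (fine (bigRatio Lc k) M'))), Sum.inl b'.2) (t'.1 : ↥(pbox M'))
      have hT : towerTorus Lc (fine Lc M) k = fine (bigRatio Lc k) M := towerTorus_fine_eq_fine Lc M k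
      have hT' : towerTorus Lc (fine Lc M') k = fine (bigRatio Lc k) M' := towerTorus_fine_eq_fine Lc M' k
      have hq1 : quo (bigRatio Lc k) (b.1 : Site (d + 1)) ∈ pbox M := quo_mem_pbox hR (by rw [← hT]; exact b.1.2)
      have hq2 : quo (bigRatio Lc k) ((b.1 : Site (d + 1)) + unitVec b.2) ∈ pbox M := quo_mem_pbox hR (by rw [← hT]; exact hbt)
      have hq1' : quo (bigRatio Lc k) (b'.1 : Site (d + 1)) ∈ pbox M' := quo_mem_pbox hR (by rw [← hT']; exact b'.1.2)
      have hq2' : quo (bigRatio Lc k) ((b'.1 : Site (d + 1)) + unitVec b'.2) ∈ pbox M' := quo_mem_pbox hR (by rw [← hT']; exact hbt')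
      rw [tgradBlock_inl, tgradBlock_inl, pboxCongr_coe, pboxCongr_coe, tdelta_of_mem _ hq1, tdelta_of_mem _ hq2, tdelta_of_mem _ hq1', tdelta_of_mem _ hq2']
      rw [bigRatio_succ_zsmul] at hb
      have c1 : (quo (bigRatio Lc k) ((b'.1 : Site (d + 1)) + unitVec b'.2) = ((t'.1 : ↥(pbox M')) : Site (d + 1)))
          ↔ (quo (bigRatio Lc k) ((b.1 : Site (d + 1)) + unitVec b.2) = ((t.1 : ↥(pbox M)) : Site (d + 1))) := by
        rw [hb, hb2, add_right_comm, quo_add_zsmul hR, show ((t'.1 : ↥(pbox M')) : Site (d + 1)) = t'.site from rfl, ht,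
          show ((t.1 : ↥(pbox M)) : Site (d + 1)) = t.site from rfl, add_left_inj]
      have c2 : (quo (bigRatio Lc k) (b'.1 : Site (d + 1)) = ((t'.1 : ↥(pbox M')) : Site (d + 1)))
          ↔ (quo (bigRatio Lc k) (b.1 : Site (d + 1)) = ((t.1 : ↥(pbox M)) : Site (d + 1))) := by
        rw [hb, quo_add_zsmul hR, show ((t'.1 : ↥(pbox M')) : Site (d + 1)) = t'.site from rfl, ht,
          show ((t.1 : ↥(pbox M)) : Site (d + 1)) = t.site from rfl, add_left_inj]
      simp only [c1, c2]
    · obtain ⟨x', rfl, hx⟩ := corr_succ_inr Lc M M' rs hrs k v x p' hp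
      show towerGen Lc (fine Lc M) (fun j => rs (j + 1)) k b x = towerGen Lc (fine Lc M') (fun j => rs (j + 1)) k b' x'
      rw [bigRatio_succ_zsmul] at hb
      exact towerGen_apply_corr k (fine Lc M) (fine Lc M') (fun j => rs (j + 1)) (fun j => hrs (j + 1)) ((Lc : ℤ) • v) b b' x x' hx hb hb2 hbt hbt'

/-- [folklore] **`towerEvalC` AT CORRESPONDING SLOTS**: equal (induction on the depth over the closed forms of §1; the incidence block reads `quo R′` of the lower
site against the top site — covariant). -/
theorem towerEvalC_apply_corr : ∀ (k : ℕ) (M M' : Fin (d + 1) → ℕ) (rs : ℕ → (Fin (d + 1) → ℕ))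
    (hrs : ∀ j i, 0 ≤ toSite (rs j) i ∧ toSite (rs j) i < (Lc : ℤ)) (v : Site (d + 1))
    (p q : NParam Lc M rs k) (p' q' : NParam Lc M' rs k),
    ((towerEquiv Lc M' rs hrs k).symm p').site = ((towerEquiv Lc M rs hrs k).symm p).site + ((bigRatio Lc k : ℕ) : ℤ) • v →
    ((towerEquiv Lc M' rs hrs k).symm q').site = ((towerEquiv Lc M rs hrs k).symm q).site + ((bigRatio Lc k : ℕ) : ℤ) • v →
      towerEvalC Lc M rs hrs k p q = towerEvalC Lc M' rs hrs k p' q'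
  | 0, M, M', rs, hrs, v, p, q, p', q', hp, hq => by
    have hp' : Res.site (ρ := toSite (rs 0)) (N := Lc) (M := M') p' = Res.site (ρ := toSite (rs 0)) (N := Lc) (M := M) p + ((bigRatio Lc 0 : ℕ) : ℤ) • v := hp
    have hq' : Res.site (ρ := toSite (rs 0)) (N := Lc) (M := M') q' = Res.site (ρ := toSite (rs 0)) (N := Lc) (M := M) q + ((bigRatio Lc 0 : ℕ) : ℤ) • v := hq
    show (1 : Matrix (NParam Lc M rs 0) (NParam Lc M rs 0) ℝ) p q = (1 : Matrix (NParam Lc M' rs 0) (NParam Lc M' rs 0) ℝ) p' q'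
    rw [Matrix.one_apply, Matrix.one_apply]
    have c : (p = q) ↔ (p' = q') := by
      constructor
      · intro h
        exact (Res.ext_iff' p' q').2 (by rw [hp', hq', (Res.ext_iff' p q).1 h])
      · intro h
        have e := (Res.ext_iff' p' q').1 h
        rw [hp', hq'] at e
        exact (Res.ext_iff' p q).2 (add_right_cancel e)
    simp only [c]
  | k + 1, M, M', rs, hrs, v, p, q, p', q', hp, hq => by
    have hLc : 0 < Lc := Nat.pos_of_ne_zero (NeZero.ne Lc)
    have hR : 0 < bigRatio Lc k := bigRatio_pos Lc hLc k
    rcases p with t | x <;> rcases q with t₂ | x₂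
    · obtain ⟨t', rfl, ht⟩ := corr_succ_inl Lc M M' rs hrs k v t p' hp
      obtain ⟨t₂', rfl, ht₂⟩ := corr_succ_inl Lc M M' rs hrs k v t₂ q' hq
      rw [towerEvalC_succ_inl_inl, towerEvalC_succ_inl_inl]
      have c : (t = t₂) ↔ (t' = t₂') := by rw [Res.ext_iff', Res.ext_iff', ht, ht₂, add_left_inj]
      simp only [c]
    · obtain ⟨t', rfl, ht⟩ := corr_succ_inl Lc M M' rs hrs k v t p' hp
      obtain ⟨x₂', rfl, hx₂⟩ := corr_succ_inr Lc M M' rs hrs k v x₂ q' hq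
      rw [towerEvalC_succ_inl_inr, towerEvalC_succ_inl_inr]
    · obtain ⟨x', rfl, hx⟩ := corr_succ_inr Lc M M' rs hrs k v x p' hp
      obtain ⟨t₂', rfl, ht₂⟩ := corr_succ_inl Lc M M' rs hrs k v t₂ q' hq
      rw [towerEvalC_succ_inr_inl, towerEvalC_succ_inr_inl, hx, ht₂, quo_add_zsmul hR]
      have c : (quo (bigRatio Lc k) ((towerEquiv Lc (fine Lc M) (fun j => rs (j + 1)) (fun j => hrs (j + 1)) k).symm x).site + (Lc : ℤ) • v = t₂.site + (Lc : ℤ) • v)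
          ↔ (quo (bigRatio Lc k) ((towerEquiv Lc (fine Lc M) (fun j => rs (j + 1)) (fun j => hrs (j + 1)) k).symm x).site = t₂.site) := by rw [add_left_inj]
      simp only [c]
    · obtain ⟨x', rfl, hx⟩ := corr_succ_inr Lc M M' rs hrs k v x p' hp
      obtain ⟨x₂', rfl, hx₂⟩ := corr_succ_inr Lc M M' rs hrs k v x₂ q' hq
      rw [towerEvalC_succ_inr_inr, towerEvalC_succ_inr_inr]
      exact towerEvalC_apply_corr k (fine Lc M) (fine Lc M') (fun j => rs (j + 1)) (fun j => hrs (j + 1)) ((Lc : ℤ) • v) x x₂ x' x₂' hx hx₂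

end Corr

end Summit.QuantumFields.BalabanUV.Beta.FP.TorusNestedReadoutTranslate

end
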